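import Summits.QuantumFields.BalabanUV.T4Continuum.Support.NE9BridgeSizeInduction

/-!
# T⁴ programme, spine estimate NE9 (node U3, history side) — the LEAF INDEX of the formalisation swarm (typer's statement stub)

Typer unit `b2b-balaban-t4-ne9-formalise-typer` of the NE9 formalisation swarm `t4-ne9-formalise-*` (cell `pub-balaban`), cut from
the acknowledged skeleton `t4/b2b-balaban-t4-ne9-p1/SKELETON-NE9-P1.md` v1.2 (owner lineage t4-ne9-p1; co-owner roads P2∕P3 =
suppliers of the diagonal binder (L); trigger `t4/T4-NE9-TRIGGER.json`, t4-ref2 pass 59, conditions c1–c6) and recorded in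
`t4/formal/NE9/DAG.md` (row T) and `t4/formal/NE9/LEAVES.md` (§S).  THIS FILE PROVES NOTHING NEW and ASSERTS NOTHING: it gives ONE
NAME to the statement shape every END face of the row concludes, and re-exports the three END faces BY NAME with their binders
GROUPED AND LABELLED BY LEAF ID (L-S1 … L-N1 of the DAG), so that a leaf prover sees which binder its row discharges and the referee
can `#print axioms` one name per face.  Everything is a parametric DEFINITION of a proposition (`[shape]`) or a proved one-line
consequence of landed theorems (`[bookkeeping]`).  Trigger c3 VERBATIM IN SUBSTANCE: no `def … : Prop` is minted for the leaves S5
([II] Lemma 1 (1.36) TYPE), A1's two-point-in-table clause, A3 (R-4) or the fading inequality N2 — they stay DISPLAYED BINDERS of the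
theorems below; the (R-1) chain (2.15)→(2.38) is asserted by nobody; nothing printed is used as a hypothesis-free fact.

* `RootShape E W κ ℓ ω′` [shape] := `NE9 E W κ (prodModuli ℓ fun _ => ω′) ∧ FadingMemory (ℓ ∕ ω′) ω′ (prodModuli ℓ fun _ => ω′)` —
  the literal conclusion shape of `NE9LastCouplingBridge.ne9_and_fadingMemory_of_couplingTwoPoint` (END-B: `ℓ = 4·clipbar·B + pexbar +
  4·lipbar·B·qTbar`, `ω′ = ω + 4·lipbar·B·τ̄`), of `NE9VacuumSubtractedBridge.…_vacSub` (END-V: constants 8, no `pexbar`) and of the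
  `NE9BridgeSizeInduction` faces (END-S).  `T4OutputRate.NE9` ∕ `FadingMemory` are the ROOT consumed by `T4OutputRate.u3_threeBrackets` ∕
  `u3_geometric` (node U3) and `T4BetaReadOutLipschitz.ne4_of_u3_on` (node U2); memory FADES iff `ω′ < 1`
  (`T4HistoryLipschitzSegment.fade_iff`, leaf N2 — a displayed side condition of the CONSUMERS, not of the END).
* `rootShape_of_leaves` ∕ `rootShape_of_leaves_vacSub` ∕ `termSize_and_rootShape_of_leaves_sizeInduction` ∕
  `termSize_and_rootShape_of_leaves_vacSub_sizeInduction` [bookkeeping] — the END faces BY NAME, binders labelled by leaf id.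

HONEST FRAMING: rung (B)+1 bookkeeping on a FIXED finite four-torus; closing every swarm row reduces NE9 ∧ FadingMemory to the cell-wide
model O-NE9-1 (the one-step cluster representation of [II] §2 typed on the carriers — constructed by nobody yet) + the TYPE statements
O-NE9-2…5 + the arithmetic N2; NE9 is NOT PRINTED and NOT PROVED — every headline reads «NE9 ⇐ the named binders»; 0∕15 leaves
instantiated on Bałaban's objects; NOT UV stability, NOT the continuum limit by itself, NOT infinite volume, NOT a mass gap, NOT Clay;
spine PROVED 0∕9 unchanged.  HONEST DEPENDENCY: continuum YM on T⁴ ⇐ BetaPertH ∧ nine spine estimates (0/9 proved); BetaPertH ⇐ (D1) ∧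
(D4) ∧ CAP+tail; G-an2-4 gates asym, D1 and NE2/3/4.

References (TYPES∕STRUCTURE only, nothing printed is a hypothesis-free fact): [I] = [Balaban1987RG1] (0.23) p.256, (1.18) p.263,
(2.12)–(2.14) p.268; [II] = [Balaban1988RG2Cluster] (1.23)–(1.24) p.7, Lemma 1 (1.33)–(1.36) p.9, Lemma 2 (1.41)–(1.43) p.11,
(2.11)–(2.15) pp.14–15, (2.18)–(2.22) p.16, (2.23)–(2.27) pp.17–18, Lemma 3 (2.37)–(2.38) p.20, (2.40)–(2.41) p.21;
[III] = [Balaban1988Convergent] (2.27)(ii) p.259; [KoteckyPreiss1986] (1)–(4) p.492.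
-/

noncomputable section

namespace Summit.QuantumFields.BalabanUV.T4Continuum.NE9.LeafIndex

open scoped BigOperators
open Literature.MathematicalPhysics.QuantumFieldTheory.Balaban1983to89
open Literature.MathematicalPhysics.QuantumFieldTheory.Balaban1983to89.T4OutputRate
open Literature.MathematicalPhysics.QuantumFieldTheory.Balaban1983to89.T4HistoryLipschitzRecursion
open Literature.MathematicalPhysics.QuantumFieldTheory.Balaban1983to89.T4HistoryLipschitzOuter
open Literature.MathematicalPhysics.QuantumFieldTheory.Balaban1983to89.T4HistoryLipschitzActivity
open Literature.MathematicalPhysics.QuantumFieldTheory.Balaban1983to89.T4HistoryLipschitzActivity (ClusterGeom)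
open Literature.MathematicalPhysics.QuantumFieldTheory.Balaban1983to89.T4HistoryLipschitzSegment
open Summit.QuantumFields.BalabanUV.T4Continuum.NE9LastCouplingBridge
open Summit.QuantumFields.BalabanUV.T4Continuum.NE9VacuumSubtractedBridge
open Summit.QuantumFields.BalabanUV.T4Continuum.NE9BridgeSizeInduction

variable {C : Carriers}

/-! ## §1 The root shape -/

/-- **ROOT SHAPE** [shape] — joint coupling-history Lipschitz bound `T4OutputRate.NE9` with product moduli of amplitude `ℓ` and
one factor `ω′` per intermediate step, TOGETHER WITH the geometric envelope `FadingMemory (ℓ∕ω′) ω′` of those moduli: the literal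
conclusion of every END face of row NE9.  A parametric definition; nothing asserted. [folklore] -/
def RootShape {Bg : Type} (E : Functional C Bg) (W : Set (ℕ → ℝ)) (κ ℓ ω' : ℝ) : Prop :=
  NE9 E W κ (prodModuli ℓ fun _ => ω') ∧ FadingMemory (ℓ / ω') ω' (prodModuli ℓ fun _ => ω')

/-- [bookkeeping] `RootShape` unfolds to the END faces' conclusion, by `Iff.rfl`. [folklore] -/
theorem rootShape_iff {Bg : Type} {E : Functional C Bg} {W : Set (ℕ → ℝ)} {κ ℓ ω' : ℝ} :
    RootShape E W κ ℓ ω' ↔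
      NE9 E W κ (prodModuli ℓ fun _ => ω') ∧ FadingMemory (ℓ / ω') ω' (prodModuli ℓ fun _ => ω') :=
  Iff.rfl

/-- [bookkeeping] the root `T4OutputRate.NE9` (as consumed by `u3_threeBrackets`) from the root shape. [folklore] -/
theorem ne9_of_rootShape {Bg : Type} {E : Functional C Bg} {W : Set (ℕ → ℝ)} {κ ℓ ω' : ℝ} (h : RootShape E W κ ℓ ω') :
    NE9 E W κ (prodModuli ℓ fun _ => ω') :=
  h.1

/-- [bookkeeping] the fading envelope of the moduli from the root shape (useful to the consumers only when `ω′ < 1`, leaf N2 —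
`T4HistoryLipschitzSegment.fade_iff`). [folklore] -/
theorem fadingMemory_of_rootShape {Bg : Type} {E : Functional C Bg} {W : Set (ℕ → ℝ)} {κ ℓ ω' : ℝ}
    (h : RootShape E W κ ℓ ω') : FadingMemory (ℓ / ω') ω' (prodModuli ℓ fun _ => ω') :=
  h.2

/-! ## §2 The END faces BY NAME, binders grouped and labelled by leaf id (DAG.md §1B) -/

variable (G : ClusterGeom C) {Bg : Type} {Pot : Type*} [NormedAddCommGroup Pot]

/-- **END-B by name, leaf-labelled** [bookkeeping] — `NE9LastCouplingBridge.ne9_and_fadingMemory_of_couplingTwoPoint` with its thirty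
binders grouped by the leaf ids of `t4/formal/NE9/DAG.md` §1B.  L-O1 = the carriers (implicit) + `ρ`, `expl`; L-S1…L-S4, L-R1 =
printed STRUCTURE (identifications on the model); L-S5 = [II] Lemma 1 (1.36) TYPE per creation step (displayed, c3); L-A1 =
`TwoPointKP` (reductions landed; residual (R-1) = WALL); L-A2 = coupling two-point at the activity level (producer
`NE4GaussianCouplingTwoPoint.couplingTwoPoint_of_gaussian`, `NE9BirthCouplingJunction.hCup_of_insertion`); L-A3 = channel coupling
modulus (producer `NE9ChannelCouplingDeriv.channelCouplingModulus_of_hasDerivWithin`); L-A4 = explicit part (gone on END-V); L-G1∕L-G2 =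
cube geometry (proved for `CubeChart`); L-R2 = occupation (derived on END-S); L-N1 = symbolic scalars.  Conclusion: the root shape with
`ℓ = 4·clipbar·B + pexbar + 4·lipbar·B·qTbar`, `ω′ = ω + 4·lipbar·B·τ̄`. [folklore] -/
theorem rootShape_of_leaves [NormedSpace ℂ Pot] {ι : Type} {E : Functional C Bg}
    -- L-O1 [dict]: the carriers of the one-step cluster representation (cell-wide NODE O; NOT claimable in the NE9 swarm, c2)
    {W : Set (ℕ → ℝ)} {Adm : Set (Bg → C.Dom → ℝ)} {T : ℕ → (ℕ → ℝ) → (Bg → C.Dom → ℝ) → ι → ℝ}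
    {Ψ : ℕ → ℝ → (ι → ℝ) → Bg → C.Dom → ℝ} {act : ℕ → ℝ → Bg → Pot → G.P → ℂ} {𝒜 : ℕ → Set Pot}
    {n : ℕ → ℝ → Bg → G.P → ℝ} {lip clip : ℕ → ℝ} {a d : G.P → ℝ} {δ : C.Dom → ℝ}
    {κ B lipbar clipbar pexbar qTbar τbar ω : ℝ} {wt : ℕ → ι → ℝ} {τ : ℕ → ℕ → ℝ} {pex qT : ℕ → ℝ}
    (ρ : ℕ → (ι → ℝ) → Pot) (expl : ℕ → ℝ → Bg → C.Dom → ℝ)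
    -- L-S1: no term is created at step 0 ([I] (0.23) structure)
    (h0 : ScaleZeroFree E W)
    -- L-S2: admissible class of term functionals ([II] p.7, (1.34) structure)
    (hAdm : AdmissibleTerms E W Adm) (hres : AdmRestrict Adm)
    -- L-S3: the step-k channel is linear in the old terms and sums over creation steps ([I] (2.12); [II] (1.23), (1.33))
    (hadd : ChannelAdditive Adm T) (hsum : ChannelStepSum Adm T)
    -- L-S4: factorisation + representation of the new term ([I] (2.13)–(2.14); [II] (2.13)–(2.14))
    (hfac : Factorises E W T Ψ)
    (hrepr : ∀ (k : ℕ) (s : ℝ) (P : ι → ℝ) (U : Bg) (X : C.Dom),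
      Ψ k s P U X = (G.newTerm act k s U X (ρ k P)).re + expl k s U X)
    -- L-S5: ONE-RUN SIZE of the linear channel per creation step, one factor ω per later step ([II] Lemma 1 (1.36) TYPE — displayed, c3)
    (hstep : ChannelSizeAtStepNN Adm T κ wt τ)
    (hτ : ∀ k j, j ≤ k → 0 ≤ τ k j ∧ τ k j ≤ τbar * ω ^ (k - j))
    -- L-A1: size ∕ two-point-in-table ∕ Kotecký–Preiss for ONE configuration-free majorant (reductions landed; (R-1) = WALL)
    (hK : TwoPointKP G W act 𝒜 n lip a d) (hlipb : ∀ k, lip k ≤ lipbar)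
    -- L-A2: COUPLING TWO-POINT at the activity level (producer landed, (w2))
    (hclip0 : ∀ k, 0 ≤ clip k)
    (hCup : ∀ g ∈ W, ∀ g' ∈ W, ∀ (k : ℕ) (U : Bg) (X : C.Dom), C.scale X = k + 1 → ∀ Q ∈ 𝒜 k, ∀ γ ∈ G.vol X,
      ‖act k (g k) U Q γ‖ ≤ n k (g' k) U γ ∧
        ‖act k (g k) U Q γ - act k (g' k) U Q γ‖ ≤ clip k * |g k - g' k| * n k (g' k) U γ)
    (hclipb : ∀ k, clip k ≤ clipbar)
    -- L-A3: CHANNEL COUPLING MODULUS (producer landed, (w5))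
    (hqT0 : ∀ k, 0 ≤ qT k)
    (hTcup : ∀ g ∈ W, ∀ g' ∈ W, ∀ (k : ℕ) (y : ι), |T k g (E g) y - T k g' (E g) y| ≤ wt k y * (qT k * |g k - g' k|))
    (hqTb : ∀ k, qT k ≤ qTbar)
    -- L-A4: the explicit part's last-coupling modulus (GONE on END-V, (w4))
    (hexpl : ∀ g ∈ W, ∀ g' ∈ W, ∀ (k : ℕ) (U : Bg) (X : C.Dom), C.scale X = k + 1 →
      |expl k (g k) U X - expl k (g' k) U X| ≤ Real.exp (-(κ * C.d X)) * (pex k * |g k - g' k|))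
    (hpexb : ∀ k, pex k ≤ pexbar) (hpexbar : 0 ≤ pexbar)
    -- L-G1: decay extraction of a localizing family ([II] (2.27); proved for the cube geometry)
    (hdec : G.DecayExtract δ d)
    -- L-G2: pin budget ([II] (2.40)→(2.41); proved for the cube geometry)
    (hpin : G.PinBudget a δ (fun _ => B) κ) (hB : 0 ≤ B)
    -- L-R1: the reading of channel outputs as a table is 1-Lipschitz from the wt-weighted sup distance ([II] (1.36) weight)
    (hρ : ∀ (k : ℕ) (P P' : ι → ℝ) (M : ℝ), (∀ y, |P y - P' y| ≤ wt k y * M) → ‖ρ k P - ρ k P'‖ ≤ M)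
    -- L-R2: occupation (DERIVED on END-S, (w3))
    (hocc : ∀ g ∈ W, ∀ g' ∈ W, ∀ k : ℕ, ρ k (T k g' (E g)) ∈ 𝒜 k)
    -- L-N1: symbolic scalars (c6)
    (hτbar : 0 ≤ τbar) (hω : 0 ≤ ω) (hpos : 0 < ω + 4 * lipbar * B * τbar) :
    RootShape E W κ (4 * clipbar * B + pexbar + 4 * lipbar * B * qTbar) (ω + 4 * lipbar * B * τbar) :=
  ne9_and_fadingMemory_of_couplingTwoPoint G ρ expl h0 hAdm hres hadd hsum hstep hfac hclip0 hCup hqT0 hTcup hrepr hexpl hclipb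
    hpexb hpexbar hqTb hK hdec hpin hρ hocc hB hlipb hτbar hω hpos hτ

/-- **END-V by name, leaf-labelled** [bookkeeping] — `NE9VacuumSubtractedBridge.ne9_and_fadingMemory_of_couplingTwoPoint_vacSub`:
leaf L-A4 GONE (vacuum-subtracted representation `hreprV`, the coupling-free `explZ` cancels); constants 8. [folklore] -/
theorem rootShape_of_leaves_vacSub [NormedSpace ℂ Pot] {ι : Type} {E : Functional C Bg}
    -- L-O1 [dict]
    {W : Set (ℕ → ℝ)} {Adm : Set (Bg → C.Dom → ℝ)} {T : ℕ → (ℕ → ℝ) → (Bg → C.Dom → ℝ) → ι → ℝ}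
    {Ψ : ℕ → ℝ → (ι → ℝ) → Bg → C.Dom → ℝ} {act : ℕ → ℝ → Bg → Pot → G.P → ℂ} {𝒜 : ℕ → Set Pot}
    {n : ℕ → ℝ → Bg → G.P → ℝ} {lip clip : ℕ → ℝ} {a d : G.P → ℝ} {δ : C.Dom → ℝ}
    {κ B lipbar clipbar qTbar τbar ω : ℝ} {wt : ℕ → ι → ℝ} {τ : ℕ → ℕ → ℝ} {qT : ℕ → ℝ}
    (ρ : ℕ → (ι → ℝ) → Pot) (U₀ : Bg) (explZ : ℕ → Bg → C.Dom → ℝ)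
    -- L-S1
    (h0 : ScaleZeroFree E W)
    -- L-S2
    (hAdm : AdmissibleTerms E W Adm) (hres : AdmRestrict Adm)
    -- L-S3
    (hadd : ChannelAdditive Adm T) (hsum : ChannelStepSum Adm T)
    -- L-S4 (vacuum-subtracted representation, [I] (2.14) «log 𝐍″_k = 𝐄^{(k+1)}(g_k, 1)»)
    (hfac : Factorises E W T Ψ)
    (hreprV : ∀ (k : ℕ) (s : ℝ) (P : ι → ℝ) (U : Bg) (X : C.Dom),
      Ψ k s P U X = (G.newTerm act k s U X (ρ k P)).re - (G.newTerm act k s U₀ X (ρ k P)).re + explZ k U X)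
    -- L-S5 (displayed, c3)
    (hstep : ChannelSizeAtStepNN Adm T κ wt τ)
    (hτ : ∀ k j, j ≤ k → 0 ≤ τ k j ∧ τ k j ≤ τbar * ω ^ (k - j))
    -- L-A1
    (hK : TwoPointKP G W act 𝒜 n lip a d) (hlipb : ∀ k, lip k ≤ lipbar)
    -- L-A2
    (hclip0 : ∀ k, 0 ≤ clip k)
    (hCup : ∀ g ∈ W, ∀ g' ∈ W, ∀ (k : ℕ) (U : Bg) (X : C.Dom), C.scale X = k + 1 → ∀ Q ∈ 𝒜 k, ∀ γ ∈ G.vol X,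
      ‖act k (g k) U Q γ‖ ≤ n k (g' k) U γ ∧
        ‖act k (g k) U Q γ - act k (g' k) U Q γ‖ ≤ clip k * |g k - g' k| * n k (g' k) U γ)
    (hclipb : ∀ k, clip k ≤ clipbar)
    -- L-A3
    (hqT0 : ∀ k, 0 ≤ qT k)
    (hTcup : ∀ g ∈ W, ∀ g' ∈ W, ∀ (k : ℕ) (y : ι), |T k g (E g) y - T k g' (E g) y| ≤ wt k y * (qT k * |g k - g' k|))
    (hqTb : ∀ k, qT k ≤ qTbar)
    -- L-G1, L-G2
    (hdec : G.DecayExtract δ d) (hpin : G.PinBudget a δ (fun _ => B) κ) (hB : 0 ≤ B)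
    -- L-R1
    (hρ : ∀ (k : ℕ) (P P' : ι → ℝ) (M : ℝ), (∀ y, |P y - P' y| ≤ wt k y * M) → ‖ρ k P - ρ k P'‖ ≤ M)
    -- L-R2 (derived on END-S)
    (hocc : ∀ g ∈ W, ∀ g' ∈ W, ∀ k : ℕ, ρ k (T k g' (E g)) ∈ 𝒜 k)
    -- L-N1
    (hτbar : 0 ≤ τbar) (hω : 0 ≤ ω) (hpos : 0 < ω + 8 * lipbar * B * τbar) :
    RootShape E W κ (8 * clipbar * B + 8 * lipbar * B * qTbar) (ω + 8 * lipbar * B * τbar) :=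
  ne9_and_fadingMemory_of_couplingTwoPoint_vacSub G ρ U₀ explZ h0 hAdm hres hadd hsum hstep hfac hclip0 hCup hqT0 hTcup hreprV
    hclipb hqTb hK hdec hpin hρ hocc hB hlipb hτbar hω hpos hτ

/-- **END-S by name, leaf-labelled (representation with an explicit part)** [bookkeeping] —
`NE9BridgeSizeInduction.ne9_and_fadingMemory_of_couplingTwoPoint_sizeInduction`: leaf L-R2 (occupation) REPLACED by the one-run size
data (B0) `hbase`, (X) `hexplSize`, (N) `hNsucc`, `hNnn`, (R′) `hbox` ([I] (1.18) ∕ [II] (1.24), p.21, (1.36) box — TYPES); returns the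
term size bound `TermSize E W κ N` as well. [folklore] -/
theorem termSize_and_rootShape_of_leaves_sizeInduction [NormedSpace ℂ Pot] {ι : Type} {E : Functional C Bg}
    -- L-O1 [dict]
    {W : Set (ℕ → ℝ)} {Adm : Set (Bg → C.Dom → ℝ)} {T : ℕ → (ℕ → ℝ) → (Bg → C.Dom → ℝ) → ι → ℝ}
    {Ψ : ℕ → ℝ → (ι → ℝ) → Bg → C.Dom → ℝ} {act : ℕ → ℝ → Bg → Pot → G.P → ℂ} {𝒜 : ℕ → Set Pot}
    {n : ℕ → ℝ → Bg → G.P → ℝ} {lip clip : ℕ → ℝ} {a d : G.P → ℝ} {δ : C.Dom → ℝ}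
    {κ B lipbar clipbar pexbar qTbar τbar ω : ℝ} {wt : ℕ → ι → ℝ} {τ : ℕ → ℕ → ℝ} {pex qT p₀ N : ℕ → ℝ}
    (ρ : ℕ → (ι → ℝ) → Pot) (expl : ℕ → ℝ → Bg → C.Dom → ℝ)
    -- L-S1 … L-S4
    (h0 : ScaleZeroFree E W) (hAdm : AdmissibleTerms E W Adm) (hres : AdmRestrict Adm) (hadd : ChannelAdditive Adm T)
    (hsum : ChannelStepSum Adm T) (hfac : Factorises E W T Ψ)
    (hrepr : ∀ (k : ℕ) (s : ℝ) (P : ι → ℝ) (U : Bg) (X : C.Dom),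
      Ψ k s P U X = (G.newTerm act k s U X (ρ k P)).re + expl k s U X)
    -- L-S5 (displayed, c3)
    (hstep : ChannelSizeAtStepNN Adm T κ wt τ)
    (hτ : ∀ k j, j ≤ k → 0 ≤ τ k j ∧ τ k j ≤ τbar * ω ^ (k - j))
    -- L-A1
    (hK : TwoPointKP G W act 𝒜 n lip a d) (hlipb : ∀ k, lip k ≤ lipbar)
    -- L-A2
    (hclip0 : ∀ k, 0 ≤ clip k)
    (hCup : ∀ g ∈ W, ∀ g' ∈ W, ∀ (k : ℕ) (U : Bg) (X : C.Dom), C.scale X = k + 1 → ∀ Q ∈ 𝒜 k, ∀ γ ∈ G.vol X,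
      ‖act k (g k) U Q γ‖ ≤ n k (g' k) U γ ∧
        ‖act k (g k) U Q γ - act k (g' k) U Q γ‖ ≤ clip k * |g k - g' k| * n k (g' k) U γ)
    (hclipb : ∀ k, clip k ≤ clipbar)
    -- L-A3
    (hqT0 : ∀ k, 0 ≤ qT k)
    (hTcup : ∀ g ∈ W, ∀ g' ∈ W, ∀ (k : ℕ) (y : ι), |T k g (E g) y - T k g' (E g) y| ≤ wt k y * (qT k * |g k - g' k|))
    (hqTb : ∀ k, qT k ≤ qTbar)
    -- L-A4
    (hexpl : ∀ g ∈ W, ∀ g' ∈ W, ∀ (k : ℕ) (U : Bg) (X : C.Dom), C.scale X = k + 1 →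
      |expl k (g k) U X - expl k (g' k) U X| ≤ Real.exp (-(κ * C.d X)) * (pex k * |g k - g' k|))
    (hpexb : ∀ k, pex k ≤ pexbar) (hpexbar : 0 ≤ pexbar)
    -- L-G1, L-G2
    (hdec : G.DecayExtract δ d) (hpin : G.PinBudget a δ (fun _ => B) κ) (hB : 0 ≤ B)
    -- L-R1
    (hρ : ∀ (k : ℕ) (P P' : ι → ℝ) (M : ℝ), (∀ y, |P y - P' y| ≤ wt k y * M) → ‖ρ k P - ρ k P'‖ ≤ M)
    -- L-R2 REPLACED by one-run size data (B0), (X), (N), (R′)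
    (hexplSize : ∀ g ∈ W, ∀ (k : ℕ) (U : Bg) (X : C.Dom), C.scale X = k + 1 →
      |expl k (g k) U X| ≤ Real.exp (-(κ * C.d X)) * p₀ k)
    (hbase : ∀ g ∈ W, ∀ (U : Bg) (X : C.Dom), C.scale X = 0 → |E g U X| ≤ Real.exp (-(κ * C.d X)) * N 0)
    (hNsucc : ∀ j, p₀ j + B ≤ N (j + 1)) (hNnn : ∀ j, 0 ≤ N j)
    (hbox : ∀ (k : ℕ) (P : ι → ℝ), (∀ y, |P y| ≤ wt k y * sizeRadius τ N k) → ρ k P ∈ 𝒜 k)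
    -- L-N1
    (hτbar : 0 ≤ τbar) (hω : 0 ≤ ω) (hpos : 0 < ω + 4 * lipbar * B * τbar) :
    TermSize E W κ N ∧ RootShape E W κ (4 * clipbar * B + pexbar + 4 * lipbar * B * qTbar) (ω + 4 * lipbar * B * τbar) :=
  ne9_and_fadingMemory_of_couplingTwoPoint_sizeInduction G ρ expl h0 hAdm hres hadd hsum hstep hfac hclip0 hCup hqT0 hTcup hrepr
    hexpl hclipb hpexb hpexbar hqTb hK hdec hpin hρ hexplSize hbase hNsucc hNnn hbox hB hlipb hτbar hω hpos hτ

/-- **END-S by name, leaf-labelled (vacuum-subtracted representation)** [bookkeeping] —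
`NE9BridgeSizeInduction.ne9_and_fadingMemory_of_couplingTwoPoint_vacSub_sizeInduction`: neither L-A4 nor L-R2 displayed; one-run
size data (B0) `hbase`, (XZ) `hexplZ`, (N′) `hNsucc : p₀ j + 2B ≤ N (j+1)`, `hNnn`, (R′) `hbox`; constants 8. [folklore] -/
theorem termSize_and_rootShape_of_leaves_vacSub_sizeInduction [NormedSpace ℂ Pot] {ι : Type} {E : Functional C Bg}
    -- L-O1 [dict]
    {W : Set (ℕ → ℝ)} {Adm : Set (Bg → C.Dom → ℝ)} {T : ℕ → (ℕ → ℝ) → (Bg → C.Dom → ℝ) → ι → ℝ}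
    {Ψ : ℕ → ℝ → (ι → ℝ) → Bg → C.Dom → ℝ} {act : ℕ → ℝ → Bg → Pot → G.P → ℂ} {𝒜 : ℕ → Set Pot}
    {n : ℕ → ℝ → Bg → G.P → ℝ} {lip clip : ℕ → ℝ} {a d : G.P → ℝ} {δ : C.Dom → ℝ}
    {κ B lipbar clipbar qTbar τbar ω : ℝ} {wt : ℕ → ι → ℝ} {τ : ℕ → ℕ → ℝ} {qT p₀ N : ℕ → ℝ}
    (ρ : ℕ → (ι → ℝ) → Pot) (U₀ : Bg) (explZ : ℕ → Bg → C.Dom → ℝ)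
    -- L-S1 … L-S4 (vacuum-subtracted representation)
    (h0 : ScaleZeroFree E W) (hAdm : AdmissibleTerms E W Adm) (hres : AdmRestrict Adm) (hadd : ChannelAdditive Adm T)
    (hsum : ChannelStepSum Adm T) (hfac : Factorises E W T Ψ)
    (hreprV : ∀ (k : ℕ) (s : ℝ) (P : ι → ℝ) (U : Bg) (X : C.Dom),
      Ψ k s P U X = (G.newTerm act k s U X (ρ k P)).re - (G.newTerm act k s U₀ X (ρ k P)).re + explZ k U X)
    -- L-S5 (displayed, c3)
    (hstep : ChannelSizeAtStepNN Adm T κ wt τ)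
    (hτ : ∀ k j, j ≤ k → 0 ≤ τ k j ∧ τ k j ≤ τbar * ω ^ (k - j))
    -- L-A1
    (hK : TwoPointKP G W act 𝒜 n lip a d) (hlipb : ∀ k, lip k ≤ lipbar)
    -- L-A2
    (hclip0 : ∀ k, 0 ≤ clip k)
    (hCup : ∀ g ∈ W, ∀ g' ∈ W, ∀ (k : ℕ) (U : Bg) (X : C.Dom), C.scale X = k + 1 → ∀ Q ∈ 𝒜 k, ∀ γ ∈ G.vol X,
      ‖act k (g k) U Q γ‖ ≤ n k (g' k) U γ ∧
        ‖act k (g k) U Q γ - act k (g' k) U Q γ‖ ≤ clip k * |g k - g' k| * n k (g' k) U γ)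
    (hclipb : ∀ k, clip k ≤ clipbar)
    -- L-A3
    (hqT0 : ∀ k, 0 ≤ qT k)
    (hTcup : ∀ g ∈ W, ∀ g' ∈ W, ∀ (k : ℕ) (y : ι), |T k g (E g) y - T k g' (E g) y| ≤ wt k y * (qT k * |g k - g' k|))
    (hqTb : ∀ k, qT k ≤ qTbar)
    -- L-G1, L-G2
    (hdec : G.DecayExtract δ d) (hpin : G.PinBudget a δ (fun _ => B) κ) (hB : 0 ≤ B)
    -- L-R1
    (hρ : ∀ (k : ℕ) (P P' : ι → ℝ) (M : ℝ), (∀ y, |P y - P' y| ≤ wt k y * M) → ‖ρ k P - ρ k P'‖ ≤ M)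
    -- (B0), (XZ), (N′), (R′) in place of L-R2
    (hexplZ : ∀ (k : ℕ) (U : Bg) (X : C.Dom), C.scale X = k + 1 → |explZ k U X| ≤ Real.exp (-(κ * C.d X)) * p₀ k)
    (hbase : ∀ g ∈ W, ∀ (U : Bg) (X : C.Dom), C.scale X = 0 → |E g U X| ≤ Real.exp (-(κ * C.d X)) * N 0)
    (hNsucc : ∀ j, p₀ j + 2 * B ≤ N (j + 1)) (hNnn : ∀ j, 0 ≤ N j)
    (hbox : ∀ (k : ℕ) (P : ι → ℝ), (∀ y, |P y| ≤ wt k y * sizeRadius τ N k) → ρ k P ∈ 𝒜 k)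
    -- L-N1
    (hτbar : 0 ≤ τbar) (hω : 0 ≤ ω) (hpos : 0 < ω + 8 * lipbar * B * τbar) :
    TermSize E W κ N ∧ RootShape E W κ (8 * clipbar * B + 8 * lipbar * B * qTbar) (ω + 8 * lipbar * B * τbar) :=
  ne9_and_fadingMemory_of_couplingTwoPoint_vacSub_sizeInduction G ρ U₀ explZ h0 hAdm hres hadd hsum hstep hfac hclip0 hCup hqT0
    hTcup hreprV hclipb hqTb hK hdec hpin hρ hexplZ hbase hNsucc hNnn hbox hB hlipb hτbar hω hpos hτ

end Summit.QuantumFields.BalabanUV.T4Continuum.NE9.LeafIndex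

end
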